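import Summits.CriticalPhenomena.PercolationContinuityZ3.Theorems.Transplant.PlanarSkeletonFrmQuasiDefs
import Summits.CriticalPhenomena.PercolationContinuityZ3.Theorems.Transplant.SkelFrmQuasiBChoiceCreepY3
import Summits.CriticalPhenomena.PercolationContinuityZ3.Theorems.Transplant.SkelFrmBChoiceCreepY3
import Summits.CriticalPhenomena.PercolationContinuityZ3.Theorems.Transplant.SkelFrmBChoiceRegionsYCore3
import Summits.CriticalPhenomena.PercolationContinuityZ3.Theorems.Transplant.SkelPhiCorridorKGYRegions
import Summits.CriticalPhenomena.PercolationContinuityZ3.Theorems.Transplant.SkelPhiNegReachReadBK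
import Summits.CriticalPhenomena.PercolationContinuityZ3.Theorems.Transplant.SkelFrmQuasi1ChoiceDefs
import Summits.CriticalPhenomena.PercolationContinuityZ3.Theorems.Transplant.SkelFrmQuasi1ParamsLBL
import Summits.CriticalPhenomena.PercolationContinuityZ3.Theorems.Transplant.SkelFrmQuasi1ParamsPO
import Summits.CriticalPhenomena.PercolationContinuityZ3.Theorems.Transplant.SkelFrmQuasiBChoiceCreepY
import Summits.CriticalPhenomena.PercolationContinuityZ3.Theorems.Transplant.SkelFrmQuasiBChoiceNums
import Summits.CriticalPhenomena.PercolationContinuityZ3.Theorems.Transplant.SkelFrmQuasiBChoiceReadNums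
import Summits.CriticalPhenomena.PercolationContinuityZ3.Theorems.Transplant.SkelFrmQuasiBChoiceReadings
import Summits.CriticalPhenomena.PercolationContinuityZ3.Theorems.Transplant.SkelFrmQuasiBChoiceWindow3
import Summits.CriticalPhenomena.PercolationContinuityZ3.Theorems.Transplant.SkelFrmQuasiBChoiceWindowY2
import Summits.CriticalPhenomena.PercolationContinuityZ3.Theorems.Transplant.SkelFrmQuasiBParamsCorrKG
import Summits.CriticalPhenomena.PercolationContinuityZ3.Theorems.Transplant.SkelFrmQuasiBParamsCorrKG0
import Summits.CriticalPhenomena.PercolationContinuityZ3.Theorems.Transplant.SkelFrmQuasiBParamsCorrKGLen3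
import Summits.CriticalPhenomena.PercolationContinuityZ3.Theorems.Transplant.SkelFrmQuasiBParamsCorrKGLenY
import Summits.CriticalPhenomena.PercolationContinuityZ3.Theorems.Transplant.SkelFrmQuasiBParamsCorrKGY
import Summits.CriticalPhenomena.PercolationContinuityZ3.Theorems.Transplant.SkelFrmQuasiBParamsLF
import Summits.CriticalPhenomena.PercolationContinuityZ3.Theorems.Transplant.SkelFrmQuasiBParamsLFA
import Summits.CriticalPhenomena.PercolationContinuityZ3.Theorems.Transplant.SkelFrmQuasiBParamsSchedA
import HarnessLib
import Summits.CriticalPhenomena.PercolationContinuityZ3.Theorems.Transplant.SkelFrmBChoiceRegionsYW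
/-!
# GEN-Q PORT (WAVE-Q table v0.8 section 2, row G142, U-level L17; captain R-6/R-7 2026-08-27: carrier token swap `PlanarSkeletonFrmFrom ↦ PlanarSkeletonFrmQuasi`)
# of the tree module «Transplant/SkelFrmFromBChoiceRegionsYW» (sha256 b858b437c99e096a…) onto the quasi-step carrier `PlanarSkeletonFrmQuasi` (p507026): «SkelFrmQuasiBChoiceRegionsYW»

ORIGINAL TITLE: N2 (frames-only node `SamePDropOfSkeletonFrm₁`, OPEN) — (ζ″) at the (R-45) instance of record `BSlot.small3 = (76·s₀, 19·s₁)`: THE y′-CORRIDOR's PER-REGION READING ROWS at the tuple of record, `NegB.hPRY_W` —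

builds on p205010 (kernel theorem, internal audit signed; external expert review pending) — nothing in this file uses p205010; NOTHING is claimed about any open node
((N3-b), the end state).  Lane `prim-bschramm`, seat `prim-bschramm-gen-2` (gen 0; GEN-Q port pen #2 under RULING D-Q / D-Q-2; tool of record port_genq.py of the captain gen-1 g4).  Helper file (`--supports stmt-CriticalPhenomena-4575 --as helper`).
PORT RULES (U-wave r1–r4 re-used, GEN-Q hunk classes of p3-g29 #6136): declaration order, names and proof texts are those of «SkelFrmFromBChoiceRegionsYW», byte-identical except
(i) the carrier token `PlanarSkeletonFrmFrom ↦ PlanarSkeletonFrmQuasi` in binders, `namespace`/`end` lines and qualified names (module names `SkelFrmFrom… ↦ SkelFrmQuasi…`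
in imports of already-ported rows); (ii) `Φ.step ↦ Φ.qstep` with the called Steps lemma replaced by its `…Q`/`_q` twin and the cost `Φ.M` threaded (none in this file unless
listed below); (iii) `Φ.cyl_connected ↦ Φ.cyl_reach` readers (none unless listed); (iv) graph-ball radii / window floors ×`Φ.M` (none unless listed).  Carrier-free
residents stay imported/exported from the original «SkelFrmBChoiceRegionsYW» exactly as in the FrmFrom port.  Docstrings and citations are the original's.
HAND HUNKS of this row: none of class (ii); KS0 reader hunk (stmt-g33 #6324, L-FLOORMAP-1 ① reader side): `KS0.R'0 κ Φ … ↦ KS0.R'0N κ Φ (KS.NQ Φ) …` ×2 (`hg2` binders).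
-/

open scoped Classical

noncomputable section

namespace Summit.CriticalPhenomena.PercolationContinuityZ3.Theorems.Transplant

namespace PlanarSkeletonFrmQuasi

export PlanarSkeletonNeg.NegB (Aof)  -- T3-auto: resident alias replicated from the FrmFrom namespace
export PlanarSkeletonNeg.Neg (K)  -- T3-auto: resident alias replicated from the FrmFrom namespace
export PlanarSkeletonNeg.Neg (K_eq)  -- T3-auto: resident alias replicated from the FrmFrom namespace
export PlanarSkeletonNeg.Neg (Kq)  -- T3-auto: resident alias replicated from the FrmFrom namespace
export PlanarSkeletonFrm.NegB (kgSLY_eq_kgSL)  -- T3-auto: resident alias replicated from the FrmFrom namespace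

open PlanarSkeletonFrm.NegB (regionY_core3)

namespace NegB

open Literature.Probability.Percolation Literature.Probability.LatticeModels SimpleGraph
open SkelConc (Consts)
open Skelφ (shearUnit kgSL kgSLY kgM₁Y kgM₂Y kgE₁Y kgWm₂Y kgWp₂Y kgA₁Yp kgA₁Ym kgC₂Y dS rdLo rdHi KGYRows)
open TwoAxis.Para (modulus)
open Neg

section RegionsY

variable (κ : Consts) {V : Type} [DecidableEq V] [Countable V] {G : SimpleGraph V} [G.LocallyFinite] (Φ : PlanarSkeletonFrmQuasi G) (t : V) (p : unitInterval)
  (D : Skelφ.StepI.DataNS V) (g f mk : ℕ)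

/- The tuple's atoms as hygiene-free local notations (they expand syntactically at each use; importers see the expanded terms; `HKᵣ` mentions the
   binders `hN hg` of the theorem it is used in). -/
set_option hygiene false in local notation "NYᵣ" => kgNYv0 κ Φ t p D g f mk (qxYQ4 κ Φ t p D g f) (WxYQ4 κ Φ t p D g f)
set_option hygiene false in local notation "qYᵣ" => kgqY κ Φ t p D g f (qxYQ4 κ Φ t p D g f)
set_option hygiene false in local notation "WYᵣ" => kgWY κ Φ t p D g f (WxYQ4 κ Φ t p D g f)
set_option hygiene false in local notation "Rᵣ" => kgR κ Φ t p D mk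
set_option hygiene false in local notation "nᵣ" => nL κ Φ t p D g f
set_option hygiene false in local notation "ℓᵣ" => ℓL κ Φ t p D g f
set_option hygiene false in local notation "hᵣ" => hL κ Φ t p D g f
set_option hygiene false in local notation "vᵣ" => vL κ Φ t p D g f
set_option hygiene false in local notation "Uᵣ" => shearUnit (nL κ Φ t p D g f) (hL κ Φ t p D g f)
set_option hygiene false in local notation "Δᵣ" => modulus (nL κ Φ t p D g f) (hL κ Φ t p D g f) (vL κ Φ t p D g f) (vβL κ Φ t p D g f)
set_option hygiene false in local notation "sLᵣ" => kgSL (nL κ Φ t p D g f) (ℓL κ Φ t p D g f) (hL κ Φ t p D g f)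
set_option hygiene false in local notation "s0ᵣ" => (((fcellsA κ Φ t p D g f).s 0 : ℕ) : ℤ)
set_option hygiene false in local notation "s1ᵣ" => (((fcellsA κ Φ t p D g f).s 1 : ℕ) : ℤ)
set_option hygiene false in local notation "r0ᵣ" => (((fcellsA κ Φ t p D g f).r 0 : ℕ) : ℤ)
set_option hygiene false in local notation "r1ᵣ" => (((fcellsA κ Φ t p D g f).r 1 : ℕ) : ℤ)
set_option hygiene false in local notation "Kᵣ" => ((Neg.K κ : ℕ) : ℤ)
set_option hygiene false in local notation "kqᵣ" => ((Neg.Kq κ : ℕ) : ℤ)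
set_option hygiene false in local notation "m1ᵣ" => kgM₁Y (nL κ Φ t p D g f) (vL κ Φ t p D g f) (kgR κ Φ t p D mk) 0 (kgWY κ Φ t p D g f (WxYQ4 κ Φ t p D g f)) (kgNYv0 κ Φ t p D g f mk (qxYQ4 κ Φ t p D g f) (WxYQ4 κ Φ t p D g f))
set_option hygiene false in local notation "m2ᵣ" => kgM₂Y (nL κ Φ t p D g f) (ℓL κ Φ t p D g f) (hL κ Φ t p D g f) (vL κ Φ t p D g f) (kgR κ Φ t p D mk) 0 (kgqY κ Φ t p D g f (qxYQ4 κ Φ t p D g f)) (kgWY κ Φ t p D g f (WxYQ4 κ Φ t p D g f)) (kgNYv0 κ Φ t p D g f mk (qxYQ4 κ Φ t p D g f) (WxYQ4 κ Φ t p D g f))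
set_option hygiene false in local notation "Wm2ᵣ" => kgWm₂Y (nL κ Φ t p D g f) (vL κ Φ t p D g f) (kgR κ Φ t p D mk) 0 (kgWY κ Φ t p D g f (WxYQ4 κ Φ t p D g f)) (kgNYv0 κ Φ t p D g f mk (qxYQ4 κ Φ t p D g f) (WxYQ4 κ Φ t p D g f))
set_option hygiene false in local notation "Wp2ᵣ" => kgWp₂Y (nL κ Φ t p D g f) (vL κ Φ t p D g f) (kgR κ Φ t p D mk) 0 (kgWY κ Φ t p D g f (WxYQ4 κ Φ t p D g f)) (kgNYv0 κ Φ t p D g f mk (qxYQ4 κ Φ t p D g f) (WxYQ4 κ Φ t p D g f))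
set_option hygiene false in local notation "HKᵣ" => kgYRows0_of κ Φ t p D g f mk (qxYQ4 κ Φ t p D g f) (WxYQ4 κ Φ t p D g f) hN hg
set_option hygiene false in local notation "rdLoᵣ" => rdLo (Aof κ) (nL κ Φ t p D g f) (hL κ Φ t p D g f) (vL κ Φ t p D g f) (vβL κ Φ t p D g f) (prFA κ Φ t p D g f).c₀ (prFA κ Φ t p D g f).c₁ (prFA κ Φ t p D g f).D
set_option hygiene false in local notation "rdHiᵣ" => rdHi (Aof κ) (nL κ Φ t p D g f) (hL κ Φ t p D g f) (vL κ Φ t p D g f) (vβL κ Φ t p D g f) (prFA κ Φ t p D g f).c₀ (prFA κ Φ t p D g f).c₁ (prFA κ Φ t p D g f).D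
set_option hygiene false in local notation "L3ᵣ" => ((3 * (nL κ Φ t p D g f * ℓL κ Φ t p D g f) / shearUnit (nL κ Φ t p D g f) (hL κ Φ t p D g f) + 1 : ℕ) : ℤ)
set_option hygiene false in local notation "P0ᵣ" => ((nL κ Φ t p D g f : ℕ) : ℤ) * ℓL κ Φ t p D g f / (shearUnit (nL κ Φ t p D g f) (hL κ Φ t p D g f) : ℕ)
set_option hygiene false in local notation "dSᵣ" => (((dS (nL κ Φ t p D g f) (ℓL κ Φ t p D g f) (hL κ Φ t p D g f) : ℕ)) : ℤ)
set_option hygiene false in local notation "Apᵣ" => ((kgA₁Yp (nL κ Φ t p D g f) (vL κ Φ t p D g f) (kgR κ Φ t p D mk) (kgWY κ Φ t p D g f (WxYQ4 κ Φ t p D g f)) (kgNYv0 κ Φ t p D g f mk (qxYQ4 κ Φ t p D g f) (WxYQ4 κ Φ t p D g f)) : ℕ) : ℤ)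
set_option hygiene false in local notation "Amᵣ" => ((kgA₁Ym (nL κ Φ t p D g f) (vL κ Φ t p D g f) (kgR κ Φ t p D mk) (kgWY κ Φ t p D g f (WxYQ4 κ Φ t p D g f)) (kgNYv0 κ Φ t p D g f mk (qxYQ4 κ Φ t p D g f) (WxYQ4 κ Φ t p D g f)) : ℕ) : ℤ)
set_option hygiene false in local notation "SCHᵣ" => Skelφ.kgCorrSchedY (HKᵣ).hn (HKᵣ).hv (HKᵣ).hlay ((HKᵣ).kgYVals_ok₁ NYᵣ) ((HKᵣ).kgYVals_ok₂ NYᵣ) ((HKᵣ).kgYVals_split NYᵣ)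

/-- **THE TUPLE's NUMBERS FOR THE REGION BOXES** (one conjunction, read once per region type). [this work] -/
theorem regionY_facts_W (κ : Consts) {V : Type} [DecidableEq V] [Countable V] {G : SimpleGraph V} [G.LocallyFinite] (Φ : PlanarSkeletonFrmQuasi G) (t : V) (p : unitInterval) (D : Skelφ.StepI.DataNS V) (g : ℕ) (f : ℕ) (mk : ℕ) (hKq : 5 ≤ Neg.Kq κ) (hN : EqNumL κ Φ t p D g f) (hg : gFloorKG κ Φ t p D mk ≤ g) (hg2 : 40 * Neg.K κ * KS0.R'0N κ Φ (KS.NQ Φ) t p D mk ≤ g) :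
    1 ≤ ((Uᵣ : ℕ) : ℤ) ∧ 958 ≤ sLᵣ ∧ ((Uᵣ : ℕ) : ℤ) * sLᵣ ≤ Δᵣ ∧ Δᵣ ≤ ((Uᵣ : ℕ) : ℤ) * sLᵣ + 2 * ((Uᵣ : ℕ) : ℤ) ∧ 1 ≤ ((nᵣ : ℕ) : ℤ) ∧ |vᵣ| ≤ ((nᵣ : ℕ) : ℤ) ∧ 5 ≤ kqᵣ ∧ 1 ≤ s0ᵣ ∧ 1 ≤ s1ᵣ ∧
      r0ᵣ = 40 * kqᵣ * s0ᵣ ∧ r1ᵣ = 40 * kqᵣ * s1ᵣ ∧ ((NYᵣ : ℕ) : ℤ) + 1 ≤ 840 * kqᵣ + 3 ∧ (((NYᵣ : ℕ) : ℤ) + 1) * ((Rᵣ : ℕ) : ℤ) + 1 ≤ ((nᵣ : ℕ) : ℤ) ∧ (((NYᵣ : ℕ) : ℤ) + 1) * ((Rᵣ : ℕ) : ℤ) ≤ sLᵣ + 1 ∧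
      ((WYᵣ : ℕ) : ℤ) = 98 * ((nᵣ : ℕ) : ℤ) ∧ (((((nᵣ : ℕ) : ℤ) + vᵣ).toNat : ℕ) : ℤ) = ((nᵣ : ℕ) : ℤ) + vᵣ ∧ (((((nᵣ : ℕ) : ℤ) - vᵣ).toNat : ℕ) : ℤ) = ((nᵣ : ℕ) : ℤ) - vᵣ ∧
      ((qYᵣ : ℕ) : ℤ) = P0ᵣ + 1 + 19 * sLᵣ + 42 ∧ 3 * (((nᵣ : ℕ) : ℤ) * ℓᵣ) / (Uᵣ : ℕ) + 1 ≤ 3 * sLᵣ + 6 ∧ sLᵣ ≤ P0ᵣ ∧ P0ᵣ ≤ sLᵣ + 1 ∧ dSᵣ ≤ 2 ∧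
      ((m1ᵣ : ℕ) : ℤ) + 1 ≤ 198 ∧ ((m2ᵣ : ℕ) : ℤ) + 1 ≤ 42 ∧ ((Wm2ᵣ : ℕ) : ℤ) + ((Wp2ᵣ : ℕ) : ℤ) ≤ 5 * ((nᵣ : ℕ) : ℤ) ∧ 241 * ((Rᵣ : ℕ) : ℤ) + 1 ≤ ((nᵣ : ℕ) : ℤ) ∧
      241 * ((Rᵣ : ℕ) : ℤ) ≤ sLᵣ + 1 ∧ 40 * Kᵣ ≤ sLᵣ + 1 ∧ Kᵣ = 40 * kqᵣ ∧ 0 ≤ ((Rᵣ : ℕ) : ℤ) ∧ (((nᵣ : ℕ) : ℤ) * ℓᵣ - (Uᵣ : ℕ) + 1) / (Uᵣ : ℕ) = sLᵣ ∧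
      vᵣ ≤ ((nᵣ : ℕ) : ℤ) ∧ -((nᵣ : ℕ) : ℤ) ≤ vᵣ ∧ (((NYᵣ : ℕ) : ℤ) + 1) * dSᵣ ≤ (((NYᵣ : ℕ) : ℤ) + 1) * 2 ∧ 0 ≤ 3 * (((nᵣ : ℕ) : ℤ) * ℓᵣ) / (Uᵣ : ℕ) + 1 ∧ 0 ≤ (((NYᵣ : ℕ) : ℤ) + 1) * dSᵣ ∧ 0 ≤ (((NYᵣ : ℕ) : ℤ) + 1) * ((Rᵣ : ℕ) : ℤ) ∧
      Apᵣ = ((nᵣ : ℕ) : ℤ) - vᵣ + ((WYᵣ : ℕ) : ℤ) + (((NYᵣ : ℕ) : ℤ) + 1) * ((Rᵣ : ℕ) : ℤ) ∧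
      Amᵣ = ((nᵣ : ℕ) : ℤ) + vᵣ + ((WYᵣ : ℕ) : ℤ) + (((NYᵣ : ℕ) : ℤ) + 1) * ((Rᵣ : ℕ) : ℤ) ∧
      kgC₂Y nᵣ ℓᵣ hᵣ vᵣ Rᵣ 0 qYᵣ WYᵣ NYᵣ m1ᵣ Wp2ᵣ 0 = (((NYᵣ : ℕ) : ℤ) + 1) * vᵣ + Apᵣ + ((((m1ᵣ : ℕ) : ℤ)) + 1) * (((Rᵣ : ℕ) : ℤ) + ((0 : ℕ) : ℤ)) - ((Wp2ᵣ : ℕ) : ℤ) := by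
  obtain ⟨hsc0, hsc1, hn1, hA0, hDp, hm, -, -, hkq, -⟩ := hsc_Q κ Φ t p D g f hN
  obtain ⟨hnR', hs40, hbig, hR1, hK40, -⟩ := valsQ_floor κ Φ t p D g f mk hN hg hg2
  have hUs := UsL_le_modulus κ Φ t p D g f hN
  have hNle : ((NYᵣ : ℕ) : ℤ) ≤ 21 * Kᵣ + 2 := by exact_mod_cast kgNYv0_le κ Φ t p D g f mk (qxYQ4 κ Φ t p D g f) (WxYQ4 κ Φ t p D g f) hN hg
  have H := kgYRows0_of κ Φ t p D g f mk (qxYQ4 κ Φ t p D g f) (WxYQ4 κ Φ t p D g f) hN hg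
  obtain ⟨-, -, hE3⟩ := H.kgE₁Y_spec NYᵣ
  obtain ⟨hnv1, hnv2⟩ := H.toNat_eq
  have hv := hN.v_le
  have hd1eq := (dec₁Y_eq_Q κ Φ t p D g f mk).1
  have hWY := WY_eq_3 κ Φ t p D g f
  obtain ⟨-, ha1⟩ := a1Y_bounds_3 κ Φ t p D g f mk hKq hN hg hg2 NYᵣ hNle
  obtain ⟨-, ha2⟩ := a2Y_le_3 κ Φ t p D g f mk hKq hN hg hg2 NYᵣ hNle
  have hsum : (((Wm2ᵣ : ℕ) : ℤ)) + ((Wp2ᵣ : ℕ) : ℤ) = ((kgE₁Y nᵣ vᵣ Rᵣ 0 WYᵣ NYᵣ : ℕ) : ℤ) := by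
    exact_mod_cast Skelφ.kgWm₂Y_add_kgWp₂Y (n := nᵣ) (v := vᵣ) (R' := Rᵣ) (ρ := 0) (W := WYᵣ) NYᵣ
  have hq := kgqY_qxYQ4 κ Φ t p D g f hN
  have hP0 := kgSL_le_natDiv κ Φ t p D g f hN
  have hP1 := Skelφ.natDiv_le_kgSLY hn1 ℓᵣ hᵣ
  have hP0nat : ((nᵣ * ℓᵣ / Uᵣ : ℕ) : ℤ) = P0ᵣ := by push_cast; rfl
  rw [hP0nat] at hP0 hP1 hq
  rw [kgSLY_eq_kgSL] at hP1
  have hdS : dSᵣ ≤ 2 := by exact_mod_cast Skelφ.dS_le_two _ _ _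
  have hUn : 0 < Uᵣ := by unfold Skelφ.shearUnit; omega
  have h3L : ((3 * (nᵣ * ℓᵣ) / Uᵣ : ℕ) : ℤ) ≤ ((3 * (nᵣ * ℓᵣ / Uᵣ) + 2 : ℕ) : ℤ) := by exact_mod_cast Skelφ.natDiv_three_le (nᵣ * ℓᵣ) Uᵣ hUn
  have h80 : 80 ≤ Neg.K κ := by have := Neg.K_eq κ; omega
  have hK80 : (80 : ℤ) ≤ Kᵣ := by exact_mod_cast h80
  have hKq' : Kᵣ = 40 * kqᵣ := by exact_mod_cast Neg.K_eq κ
  have hkqK : ((5 : ℕ) : ℤ) ≤ kqᵣ := by exact_mod_cast hKq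
  have hkq2 : (5 : ℤ) ≤ kqᵣ := by push_cast at hkqK; linarith
  have hRR : ((KS0.R'0N κ Φ (KS.NQ Φ) t p D mk : ℕ) : ℤ) = ((Rᵣ : ℕ) : ℤ) := rfl
  rw [hRR] at hnR' hR1 hs40
  have hR0 : (0 : ℤ) ≤ ((Rᵣ : ℕ) : ℤ) := by linarith
  have hNR : (((NYᵣ : ℕ) : ℤ) + 1) * ((Rᵣ : ℕ) : ℤ) ≤ (21 * Kᵣ + 3) * ((Rᵣ : ℕ) : ℤ) := mul_le_mul_of_nonneg_right (by linarith) hR0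
  have h21 : (21 * Kᵣ + 3) * ((Rᵣ : ℕ) : ℤ) ≤ 40 * Kᵣ * ((Rᵣ : ℕ) : ℤ) := mul_le_mul_of_nonneg_right (by linarith) hR0
  have h105 : 241 * ((Rᵣ : ℕ) : ℤ) ≤ 40 * Kᵣ * ((Rᵣ : ℕ) : ℤ) := mul_le_mul_of_nonneg_right (by linarith) hR0
  have hKKR : Kᵣ ≤ Kᵣ * ((Rᵣ : ℕ) : ℤ) := le_mul_of_one_le_right (by linarith) hR1
  have hU : (0 : ℤ) < (Uᵣ : ℕ) := Skelφ.shearUnit_pos hn1 _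
  have hΔU : Δᵣ ≤ ((Uᵣ : ℕ) : ℤ) * sLᵣ + 2 * ((Uᵣ : ℕ) : ℤ) := by
    have hmod := (Skelφ.NegPrm.modulus_vβOf hn1 hᵣ ℓᵣ vᵣ).2
    have hvβ : vβL κ Φ t p D g f = Skelφ.NegPrm.vβOf nᵣ hᵣ ℓᵣ vᵣ := rfl
    rw [← hvβ] at hmod
    have hfl := Int.lt_mul_ediv_self_add (x := ((nᵣ : ℕ) : ℤ) * ℓᵣ - (Uᵣ : ℕ) + 1) hU
    unfold Skelφ.kgSL; linarith
  have hr0 : r0ᵣ = 40 * kqᵣ * s0ᵣ := by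
    rw [PCells2.r_eq, show ((fcellsA κ Φ t p D g f).K : ℤ) = Neg.K κ by exact_mod_cast (fcellsA_K κ Φ t p D g f).1, show (Neg.K κ : ℤ) = 40 * kqᵣ from hKq']
  have hr1 : r1ᵣ = 40 * kqᵣ * s1ᵣ := by
    rw [PCells2.r_eq, show ((fcellsA κ Φ t p D g f).K : ℤ) = Neg.K κ by exact_mod_cast (fcellsA_K κ Φ t p D g f).1, show (Neg.K κ : ℤ) = 40 * kqᵣ from hKq']
  have hs0 : (1 : ℤ) ≤ s0ᵣ := by exact_mod_cast (fcellsA κ Φ t p D g f).hs 0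
  have hs1 : (1 : ℤ) ≤ s1ᵣ := by exact_mod_cast (fcellsA κ Φ t p D g f).hs 1
  have hAp : Apᵣ = ((nᵣ : ℕ) : ℤ) - vᵣ + ((WYᵣ : ℕ) : ℤ) + (((NYᵣ : ℕ) : ℤ) + 1) * ((Rᵣ : ℕ) : ℤ) := by
    unfold Skelφ.kgA₁Yp; push_cast; rw [hnv2]
  have hAm : Amᵣ = ((nᵣ : ℕ) : ℤ) + vᵣ + ((WYᵣ : ℕ) : ℤ) + (((NYᵣ : ℕ) : ℤ) + 1) * ((Rᵣ : ℕ) : ℤ) := by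
    unfold Skelφ.kgA₁Ym; push_cast; rw [hnv1]
  have hC2 : kgC₂Y nᵣ ℓᵣ hᵣ vᵣ Rᵣ 0 qYᵣ WYᵣ NYᵣ m1ᵣ Wp2ᵣ 0 = (((NYᵣ : ℕ) : ℤ) + 1) * vᵣ + Apᵣ + ((((m1ᵣ : ℕ) : ℤ)) + 1) * (((Rᵣ : ℕ) : ℤ) + ((0 : ℕ) : ℤ)) - ((Wp2ᵣ : ℕ) : ℤ) := by
    rw [Skelφ.kgC₂Y_zero]; simp only [ChainPara.ParkPrm.aHi, Skelφ.kgPark₁Y, Skelφ.xParkPrmW]; push_cast; ring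
  refine ⟨by linarith, hbig, hUs, hΔU, by exact_mod_cast hn1, hv, hkq2, hs0, hs1, hr0, hr1, by linarith, by linarith, by linarith, hWY, hnv1, hnv2,
    by linarith, ?_, hP0, hP1, hdS, ha1, ha2, by linarith, by linarith, by linarith, by linarith, hKq', hR0, rfl,
    (abs_le.1 hv).2, by linarith [(abs_le.1 hv).1], mul_le_mul_of_nonneg_left hdS (by positivity),
    by have : (0 : ℤ) ≤ 3 * (((nᵣ : ℕ) : ℤ) * ℓᵣ) / (Uᵣ : ℕ) := Int.ediv_nonneg (by positivity) (by positivity)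
       linarith, by positivity, by positivity, hAp, hAm, hC2⟩
  push_cast at h3L ⊢
  linarith

-- GEN-Q (R-2, captain 2026-08-27): `PlanarSkeletonFrmFrom.NegB.regionY_run_W` is not in the used cone of the node top — not ported.

-- GEN-Q (R-2, captain 2026-08-27): `PlanarSkeletonFrmFrom.NegB.regionY_park₁_W` is not in the used cone of the node top — not ported.

-- GEN-Q (R-2, captain 2026-08-27): `PlanarSkeletonFrmFrom.NegB.regionY_park₂_W` is not in the used cone of the node top — not ported.

-- GEN-Q (R-2, captain 2026-08-27): `PlanarSkeletonFrmFrom.NegB.hPRY_W` is not in the used cone of the node top — not ported.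

end RegionsY

end NegB

end PlanarSkeletonFrmQuasi

end Summit.CriticalPhenomena.PercolationContinuityZ3.Theorems.Transplant

end
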